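import Literature.NumberTheory.Sieve.QuadraticRootsPrimeModuliDFIAssembly2
import Literature.NumberTheory.Sieve.QuadraticRootsPrimeModuliDFIProofs
import Literature.NumberTheory.Sieve.QuadraticRootsPrimeModuliToth
import HarnessLib

/-!
# Duke–Friedlander–Iwaniec 1995: the theorem reduced to Proposition 4 alone (PROVED reductions)

Topic `Literature/NumberTheory/Sieve`, proofs companion of `PolynomialCongruencesPrimeModuli.lean`
(the named fact `Literature.NumberTheory.Sieve.dukeFriedlanderIwaniec1995_quadraticRoots_primeModuli`:
for `f = aX² + 2bX + c ∈ ℤ[X]` with `ac − b² > 0` and every `h ≠ 0`,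
`∑_{p ≤ x} ρ_h(p) = o(π(x))`, `ρ_h(n) = ∑_{f(ν) ≡ 0 (mod n)} e(hν/n)`; W. Duke, J. B. Friedlander,
H. Iwaniec, Ann. of Math. (2) 141 (1995), 423–441, Theorem p. 424).

State of the formalisation of the printed proof (§§2–7 of the paper):

* §6, **Theorem 5** (the sieve for complex sequences) is PROVED:
  `dukeFriedlanderIwaniec1995_theorem5_holds` (`QuadraticRootsPrimeModuliDFIProofs.lean`);
* §7, the assembly (Theorem 5 applied to `c_n = ρ_h(n)/B_f`, (34) from Proposition 1, (35) from
  Proposition 2, `ε → 0`) is PROVED (`QuadraticRootsPrimeModuliDFIAssembly.lean`,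
  `…DFIReduction.lean`, `…DFILinear.lean`, `…DFIBilinear.lean`);
* §4 (Proposition 1 from Proposition 4 by un-smoothing) and §5 (Proposition 2 from (25), i.e. from
  Proposition 4, by Cauchy's inequality) are PROVED (`…DFIUnsmoothing.lean`, `…DFIProposition2.lean`,
  combined in `…DFIAssembly2.lean`);
* §§2–3, **Proposition 4** (smoothed linear forms `∑_{n ≡ 0 (d)} ρ_h(n) G(n)`, from the
  correspondence roots ↔ `Γ₀(q)`-orbits of Heegner points (13)–(14) and Proposition 3: the spectral
  theorem on `Γ₀(q)∖ℍ`, the pre-trace formula (16), the Kuznetsov formula (21) and Weil's bound for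
  Kloosterman sums, (23)) remains the named fact `dukeFriedlanderIwaniec1995_proposition4`
  (`QuadraticRootsPrimeModuliDFI.lean`) — the one non-elementary input, whose theory (spectral
  decomposition of `L²(Γ₀(q)∖ℍ)`, Kuznetsov's formula) is absent from Mathlib; of its ingredients
  only Weil's bound is in the tree (`Literature.NumberTheory.LFunctions.weil_kloosterman_bound_holds`).

Consequently the trust base of the fact along the printed lines is now EXACTLY Proposition 4, and
this file records the corresponding closed-form reductions, with Theorem 5 discharged:

* `dukeFriedlanderIwaniec1995_quadraticRoots_primeModuli_of_hyp34_hyp35` — the theorem from the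
  hypotheses (34), (35) of Theorem 5 for the sequences `ρ_h` (`h ≥ 1`, `0 < ε ≤ 1/12`) alone,
  whatever their provenance [cite: DukeFriedlanderIwaniec1995, §7 p. 438];
* `dukeFriedlanderIwaniec1995_quadraticRoots_primeModuli_of_proposition1_of_proposition2`
  [cite: DukeFriedlanderIwaniec1995, §7 p. 438];
* `dukeFriedlanderIwaniec1995_quadraticRoots_primeModuli_of_proposition4` — **Proposition 4 ⇒ the
  theorem** [cite: DukeFriedlanderIwaniec1995, §§4, 5, 7];
* `dukeFriedlanderIwaniecToth_quadraticRoots_primeModuli_of_proposition4_of_toth` — the merged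
  Duke–Friedlander–Iwaniec–Tóth fact of `PolynomialCongruences.lean` from Proposition 4 and Tóth's
  theorem (positive discriminant) [cite: Toth2000, main theorem];
* `toth2000_quadraticRoots_primeModuli_of_hyp34_hyp35` — Tóth's theorem from (34)–(35) for every
  irreducible quadratic of positive discriminant (Theorem 5 discharged in
  `toth2000_quadraticRoots_primeModuli_of_theorem5`).

The discharge `dukeFriedlanderIwaniec1995_quadraticRoots_primeModuli_holds` is then the one-liner
`dukeFriedlanderIwaniec1995_quadraticRoots_primeModuli_of_proposition4 ‹proposition4_holds›`, to be
appended here once Proposition 4 is proved.  No named fact is introduced in this file.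

## References

* W. Duke, J. B. Friedlander, H. Iwaniec, *Equidistribution of roots of a quadratic congruence to
  prime moduli*, Ann. of Math. (2) 141 (1995), 423–441: Theorem (p. 424), Propositions 1, 2
  (pp. 425–426), Propositions 3, 4 and (25) (pp. 431–432), Theorem 5 (p. 437), §7 (p. 438).
  [cite: DukeFriedlanderIwaniec1995, Theorem p. 424, Propositions 1–4, Theorem 5, §7]
* Á. Tóth, *Roots of quadratic congruences*, Internat. Math. Res. Notices 2000, no. 14, 719–739.
  [cite: Toth2000, main theorem]
-/

namespace Literature.NumberTheory.Sieve

open scoped BigOperators Polynomial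
open Filter Asymptotics Finset Polynomial

/-- **DFI's theorem from (34) and (35) alone (Theorem 5 discharged).**  If for every
`f = aX² + 2bX + c` with `ac − b² > 0`, every `h ≥ 1` and every `0 < ε ≤ 1/12` the sequence
`c_n = ρ_h(n)` satisfies the hypotheses (34) (`DFI1995.Hyp34`, level `x^{1/2−ε}`) and (35)
(`DFI1995.Hyp35`, `y = x^{1/3−ε}`, `w = x^{(log log x)^{−3}}`) of Theorem 5, then
`∑_{p ≤ x} ρ_h(p) = o(π(x))` for every `h ≠ 0` (`h < 0` by conjugation, `ρ_{−h} = conj ∘ ρ_h`).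
[cite: DukeFriedlanderIwaniec1995, §7 p. 438 (with Theorem 5 p. 437)] -/
theorem dukeFriedlanderIwaniec1995_quadraticRoots_primeModuli_of_hyp34_hyp35
    (H34 : ∀ a b c : ℤ, 0 < a * c - b ^ 2 → ∀ h : ℕ, 1 ≤ h → ∀ ε : ℝ, 0 < ε → ε ≤ 1 / 12 →
      DFI1995.Hyp34 (DFI1995.quad a b c) h ε)
    (H35 : ∀ a b c : ℤ, 0 < a * c - b ^ 2 → ∀ h : ℕ, 1 ≤ h → ∀ ε : ℝ, 0 < ε → ε ≤ 1 / 12 →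
      DFI1995.Hyp35 (DFI1995.quad a b c) h ε) :
    dukeFriedlanderIwaniec1995_quadraticRoots_primeModuli := by
  intro a b c hD h hh
  change (fun P : ℕ => ∑ p ∈ Nat.primesLE P, polyRootWeylSum (DFI1995.quad a b c) p h) =o[atTop]
    fun P : ℕ => (Nat.primeCounting P : ℝ)
  have key : ∀ m : ℕ, 1 ≤ m →
      (fun P : ℕ => ∑ p ∈ Nat.primesLE P, polyRootWeylSum (DFI1995.quad a b c) p (m : ℤ))
        =o[atTop] fun P : ℕ => (Nat.primeCounting P : ℝ) := fun m hm =>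
    DFI1995.isLittleO_sum_primesLE_of_theorem5 dukeFriedlanderIwaniec1995_theorem5_holds hD (h := m)
      (fun ε hε hε12 => H34 a b c hD m hm ε hε hε12) (fun ε hε hε12 => H35 a b c hD m hm ε hε hε12)
  rcases lt_or_gt_of_ne hh with hneg | hpos
  · -- `h < 0`: conjugate
    obtain ⟨m, hm⟩ := Int.exists_eq_neg_ofNat (le_of_lt hneg)
    have hm1 : 1 ≤ m := by omega
    refine IsLittleO.of_norm_left ?_
    have hnorm : ∀ P : ℕ, ‖∑ p ∈ Nat.primesLE P, polyRootWeylSum (DFI1995.quad a b c) p h‖ =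
        ‖∑ p ∈ Nat.primesLE P, polyRootWeylSum (DFI1995.quad a b c) p (m : ℤ)‖ := by
      intro P
      rw [hm, show (-(m : ℤ) : ℤ) = -((m : ℕ) : ℤ) from rfl]
      simp_rw [polyRootWeylSum_neg]
      rw [← map_sum, RCLike.norm_conj]
    simp_rw [hnorm]
    exact (key m hm1).norm_left
  · obtain ⟨m, hm⟩ := Int.eq_ofNat_of_zero_le (le_of_lt hpos)
    have hm1 : 1 ≤ m := by omega
    rw [hm]
    exact key m hm1

/-- **DFI's theorem from Propositions 1 and 2 (Theorem 5 discharged).**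
[cite: DukeFriedlanderIwaniec1995, §7 p. 438] -/
theorem dukeFriedlanderIwaniec1995_quadraticRoots_primeModuli_of_proposition1_of_proposition2
    (H1 : dukeFriedlanderIwaniec1995_proposition1) (H2 : dukeFriedlanderIwaniec1995_proposition2) :
    dukeFriedlanderIwaniec1995_quadraticRoots_primeModuli :=
  dukeFriedlanderIwaniec1995_quadraticRoots_primeModuli_of_theorem5
    dukeFriedlanderIwaniec1995_theorem5_holds H1 H2

/-- **DFI's theorem from Proposition 4 alone** — the whole printed proof with its single
non-elementary input (the spectral bound for smoothed linear forms, §§2–3) left as hypothesis: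
§4 gives Proposition 1, §5 gives Proposition 2, §6 (Theorem 5, proved) and §7 assemble.
[cite: DukeFriedlanderIwaniec1995, Proposition 4 p. 432 and §§4–7] -/
theorem dukeFriedlanderIwaniec1995_quadraticRoots_primeModuli_of_proposition4
    (H4 : dukeFriedlanderIwaniec1995_proposition4) :
    dukeFriedlanderIwaniec1995_quadraticRoots_primeModuli :=
  dukeFriedlanderIwaniec1995_quadraticRoots_primeModuli_of_theorem5_of_proposition4
    dukeFriedlanderIwaniec1995_theorem5_holds H4

/-- **The merged Duke–Friedlander–Iwaniec–Tóth fact from Proposition 4 and Tóth's theorem.**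
[cite: DukeFriedlanderIwaniec1995, Proposition 4 p. 432 and §§4–7]; [cite: Toth2000, main theorem] -/
theorem dukeFriedlanderIwaniecToth_quadraticRoots_primeModuli_of_proposition4_of_toth
    (H4 : dukeFriedlanderIwaniec1995_proposition4) (hT : toth2000_quadraticRoots_primeModuli) :
    dukeFriedlanderIwaniecToth_quadraticRoots_primeModuli :=
  dukeFriedlanderIwaniecToth_quadraticRoots_primeModuli_of_dfi_of_toth
    (dukeFriedlanderIwaniec1995_quadraticRoots_primeModuli_of_proposition4 H4) hT

/-- **Tóth's theorem from (34)–(35) for positive discriminant (Theorem 5 discharged)**: if for every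
irreducible quadratic `f ∈ ℤ[X]` of positive discriminant, every `h ≥ 1` and every `0 < ε ≤ 1/12`
the sequence `ρ_h` satisfies (34) and (35), then `toth2000_quadraticRoots_primeModuli` holds.
[cite: Toth2000, main theorem; deduction as in DukeFriedlanderIwaniec1995 §7 with Theorem 5] -/
theorem toth2000_quadraticRoots_primeModuli_of_hyp34_hyp35
    (H34 : ∀ f : ℤ[X], f.natDegree = 2 → Irreducible f →
      0 < discrim (f.coeff 2) (f.coeff 1) (f.coeff 0) → ∀ h : ℕ, 1 ≤ h →
      ∀ ε : ℝ, 0 < ε → ε ≤ 1 / 12 → DFI1995.Hyp34 f h ε)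
    (H35 : ∀ f : ℤ[X], f.natDegree = 2 → Irreducible f →
      0 < discrim (f.coeff 2) (f.coeff 1) (f.coeff 0) → ∀ h : ℕ, 1 ≤ h →
      ∀ ε : ℝ, 0 < ε → ε ≤ 1 / 12 → DFI1995.Hyp35 f h ε) :
    toth2000_quadraticRoots_primeModuli :=
  toth2000_quadraticRoots_primeModuli_of_theorem5 dukeFriedlanderIwaniec1995_theorem5_holds H34 H35

end Literature.NumberTheory.Sieve
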